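import Summits.QuantumFields.BalabanUV.T4Continuum.Support.VariationalAdditive

/-!
# T⁴ programme, spine node NE2 (U1a), lane P2 — THE ADDITIVE BACKGROUND HYPOTHESIS SHAPE `PairDefects` of the variational route
# (tier ⁺ of `t4/skeletons/NE2-t4-ne2-p2.md` v0.5; cell `pub-balaban`, row NE2 co-owner #2, lineage t4-ne2-p2 gen 10)

HONEST FRAMING (T4-DAG p. 1).  Rung (B)+1 only — NOT infinite volume, NOT a mass gap, NOT Clay.  NE2 is NOT IN PRINT and NOT proved
here.  This module only NAMES the background tier's three leaves (existence of the two constrained minimisers, covariant Federbush with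
an additive defect at the fine minimiser, one-step consistency with an additive defect at the coarse minimiser) as ONE hypothesis shape
over abstract carriers — ASSERTED BY NOBODY — and draws the additive bracket from it by `VariationalAdditive.step_additive`.  Why additive
and not the relative `VariationalLeaves.CovariantStepLaws`: see the header of `Support/VariationalAdditive` (the relative Federbush field
is not satisfiable for covariant data with a flat section and a transport mismatch; the consumer's currency `OneStepAveragedLaw` is
additive anyway).  No `sorry`; axioms standard; nothing printed is a hypothesis; no `def … : Prop` fact.  HONEST DEPENDENCY: continuum YM
on T⁴ ⇐ BetaPertH ∧ nine spine estimates (0/9 proved); BetaPertH ⇐ (D1) ∧ (D4) ∧ CAP+tail; G-an2-4 gates asym, D1 and NE2/3/4.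
-/

namespace Summit.QuantumFields.BalabanUV.T4Continuum.VariationalPairShape

open Summit.QuantumFields.BalabanUV.T4Continuum.VariationalTransfer
open Summit.QuantumFields.BalabanUV.T4Continuum.VariationalLeaves (CovariantStepData)
open Summit.QuantumFields.BalabanUV.T4Continuum.VariationalAdditive (step_additive)

variable {V W Z : Type*}

/-! ## The background tier (NE2⁺, canonical pair) with ADDITIVE defects — hypothesis shape, asserted by nobody -/

/-- covariant one-step data for the canonical pair PLUS the fine minimiser and a size functional: `Hf` = the covariant
`(k+1)`-step minimiser at the fine background `U′` (so `Qk (Q₁ (Hf B)) = B`), `q B` = the reference size of the unit datum (in the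
instantiation `Σ_i |B_i|²`). [folklore] -/
structure PairData (V W Z : Type*) extends CovariantStepData V W Z where
  /-- the covariant `(k+1)`-step minimiser at `U′` (fine fields) -/
  Hf : Z → V
  /-- reference size of the unit datum (`‖B‖²`) -/
  q : Z → ℝ

/-- **THE BACKGROUND LEAVES AS ONE ADDITIVE HYPOTHESIS SHAPE** (NOT PRINTED, asserted by nobody; replaces the relative shape
`VariationalLeaves.CovariantStepLaws` for `U ≠ 1`): `minimiser`/`minimiser_f` = the two constrained minimisers exist (L⁺-VAR),
`federbush` = L⁺-FED evaluated AT THE FINE MINIMISER with additive defect `e·q B` (covariant Stokes/Jensen + transport mismatch),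
`consistent` = L⁺-ONE × L⁺-REG evaluated AT THE COARSE MINIMISER with additive defect `e′·q B` (explicit covariant interpolant +
regularity of `Hk B`).  For the T⁴ spine's unit-scale-smooth backgrounds the leaves are to be proved with `e, e′ = C·(1 + α²)·L^{−2k}`
(variational route, scalar covariant sector first: `t4/skeletons/NE2-t4-ne2-p2.md` v0.5 §2). [folklore] -/
structure PairDefects {V W Z : Type*} (D : PairData V W Z) (e e' : ℝ) : Prop where
  surj : Function.Surjective D.Q₁
  Sc_nonneg : ∀ A, 0 ≤ D.Sc A
  Sf_nonneg : ∀ A', 0 ≤ D.Sf A'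
  minimiser : ∀ B, D.Qk (D.Hk B) = B ∧ ∀ A₁, D.Qk A₁ = B → D.Sc (D.Hk B) ≤ D.Sc A₁
  minimiser_f : ∀ B, D.Qk (D.Q₁ (D.Hf B)) = B ∧ ∀ A', D.Qk (D.Q₁ A') = B → D.Sf (D.Hf B) ≤ D.Sf A'
  federbush : ∀ B, D.Sc (D.Q₁ (D.Hf B)) ≤ D.Sf (D.Hf B) + e * D.q B
  consistent : ∀ B, blockSpin D.Q₁ D.Sf (D.Hk B) ≤ D.Sc (D.Hk B) + e' * D.q B

/-- **NE2⁺ (canonical pair), additive form, kernel-checked modulo the shape**: `Δ_k(Ū′)(B) ≤ Δ_{k+1}(U′)(B) + e·q B` and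
`Δ_{k+1}(U′)(B) ≤ Δ_k(Ū′)(B) + e′·q B` for every unit datum `B`.  Nothing of NE3 (node U1b) is used. [folklore] -/
theorem pair_step_additive {D : PairData V W Z} {e e' : ℝ} (h : PairDefects D e e') (B : Z) :
    blockSpin D.Qk D.Sc B ≤ blockSpin (D.Qk ∘ D.Q₁) D.Sf B + e * D.q B ∧
      blockSpin (D.Qk ∘ D.Q₁) D.Sf B ≤ blockSpin D.Qk D.Sc B + e' * D.q B :=
  step_additive h.surj h.Sc_nonneg h.Sf_nonneg (h.minimiser B).1 (h.minimiser B).2 (h.minimiser_f B).1 (h.minimiser_f B).2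
    (h.federbush B) (h.consistent B)

/-- the same in absolute value with the larger constant: `|Δ_{k+1}(U′)(B) − Δ_k(Ū′)(B)| ≤ max e e′ · q B` (for `q B ≥ 0`).
[folklore] -/
theorem pair_step_abs {D : PairData V W Z} {e e' : ℝ} (h : PairDefects D e e') (B : Z) (hq : 0 ≤ D.q B) :
    |blockSpin (D.Qk ∘ D.Q₁) D.Sf B - blockSpin D.Qk D.Sc B| ≤ max e e' * D.q B := by
  obtain ⟨h₁, h₂⟩ := pair_step_additive h B
  have he : e * D.q B ≤ max e e' * D.q B := mul_le_mul_of_nonneg_right (le_max_left _ _) hq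
  have he' : e' * D.q B ≤ max e e' * D.q B := mul_le_mul_of_nonneg_right (le_max_right _ _) hq
  rw [abs_le]
  constructor <;> linarith


end Summit.QuantumFields.BalabanUV.T4Continuum.VariationalPairShape
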